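import Mathlib.Data.Nat.ModEq
import Mathlib.Data.Nat.Totient
import Mathlib.Data.Nat.Factors
import Mathlib.Data.ZMod.Basic
import Mathlib.Data.ZMod.QuotientRing
import Mathlib.RingTheory.ZMod.UnitsCyclic
import Mathlib.GroupTheory.OrderOfElement
import Mathlib.NumberTheory.Padics.PadicVal.Basic
import Mathlib.Algebra.Group.Pi.Units
import Mathlib.Data.Fintype.BigOperators
import Mathlib.Analysis.SpecialFunctions.Complex.Circle
import Literature.Computability.Cryptography.Shor
import HarnessLib

/-!
# Shor's factoring theorem `FACT ∈ BQP`: proof architecture (family PQC, pqc.S06)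

This file is the sibling "proofs" file of `Literature/Computability/Cryptography/Shor.lean`. Its
target is the named fact `Literature.PQC.FACT_mem_BQP : FACT ∈ BQP` (Shor 1997, §5, decision form).
Over the faithful circuit model of `QuantumCircuit`/`ClassBQP` (poly-time *Turing-machine*
uniformity, Clifford+T matrix semantics, Born rule) a complete proof is a whole theory, so the
proof is decomposed along the printed argument (Shor 1997, §§3–5) into named sub-results, proved
bottom-up; this file records the decomposition, proves the elementary pieces now, and proves the
*assembly* `FACT_mem_BQP_of`: the target follows from five named facts of the tree.

## Content

* **The top-level assembly** (all proved here):
  `IsQSolvable.mono` (monotonicity of search solvability in the relation),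
  `mem_BQP_of_isQSolvable_bit` (decision from search: a uniform family writing the bit
  `[x ∈ L]` on wire `0` with probability `≥ 2/3` witnesses `L ∈ BQP`; uses unitarity of
  Clifford+T through the named facts `cliffordT_isUnitary` and `QCircuit.outputPMF_apply`),
  the classical post-processor `factPost` / pre-processor `factPre` of the decision version with
  their correctness `factPost_boolPair`, `factBit_eq_true_iff`, and
  `FACT_mem_BQP_of : … → isQSolvable_factoring → FACT_mem_BQP`.
* **Named sub-facts it consumes** (statements only, cited):
  `isQSolvable_classicalWrap` (bounded-error quantum search solvability is closed under
  deterministic polynomial-time classical pre- and post-processing — the circuit form of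
  "`P`-computations are free inside `BQP`", Bernstein–Vazirani 1997 §8, Nielsen–Chuang §4.5.5),
  `factPre_mem_FP`, `factPost_mem_FP` (the two string functions are polynomial time), and, from
  `Shor.lean`, `isQSolvable_factoring` (Shor's theorem in FBQP form).
* **Shor 1997 §5, the arithmetic of the reduction and of order finding** (towards
  `isQSolvable_factoring`): proved here are Shor's gcd criterion
  `Shor1997.one_lt_gcd_pow_half_sub_one` (if `r` is even, `x ^ r ≡ 1`, `x ^ (r/2) ≢ ±1 (mod n)`
  then `gcd (x ^ (r/2) - 1, n)` is a nontrivial divisor) and the uniqueness of the rational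
  approximant `Shor1997.approximant_unique` (`q ≥ n²`: at most one `d/r`, `r < n`, within
  `1/2q` of any real); Legendre's theorem on continued-fraction convergents used next by Shor is
  Mathlib's `Real.exists_rat_eq_convergent`; and **Miller's reduction bound**
  `Shor1997_reduction_bound` (for odd `n` with `k` distinct prime factors the bad units are at
  most a `2^{-(k-1)}` fraction) is vendored as a named fact *and discharged*
  (`Shor1997_reduction_bound_holds`, via the Chinese remainder theorem on units, cyclicity of
  `(ZMod p^a)ˣ` for odd `p`, and a count of 2-adic valuations of orders in cyclic groups of even
  order: `Shor1997.two_mul_card_valSet_le`, `Shor1997.card_filter_forall_eq_mul_two_pow_le`).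
  Vendored as named facts with Shor's own statements (not yet proved):
  `Shor1997_outcomeProb_lower_bound` (the exponential-sum estimate: each good outcome `|c, x^k⟩`
  has probability `≥ 1/3r²`), `Shor1997_totient_lower_bound` (`φ(r)/r > δ / log log r`, from
  Hardy–Wright Thm 328), and `Shor1997_orderFinding_isQSolvable` (order finding is solvable in
  bounded-error quantum polynomial time — the quantum core, §5 with §§3–4).
* **Still to be vendored** (next layer, needed to assemble `isQSolvable_factoring` from the
  above): a *randomised* classical wrap — closure of `IsQSolvable` under bounded-error
  randomised polynomial-time reductions with adaptively repeated calls (the random choice of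
  `x`, the `O(log log r)` repetitions, the classical pre-tests for even `n`, prime powers and
  primes) — which the deterministic `isQSolvable_classicalWrap` below cannot express.

## Sources

* P. W. Shor, *Polynomial-time algorithms for prime factorization and discrete logarithms on a
  quantum computer*, SIAM J. Comput. 26 (1997) 1484–1509 (= arXiv:quant-ph/9508027v2), §3
  (reversible modular exponentiation), §4 (quantum Fourier transform), §5 (prime factorization;
  pp. 13–15 of the arXiv version).
* G. L. Miller, *Riemann's hypothesis and tests for primality*, JCSS 13 (1976) 300–317 (the
  reduction of factoring to order finding, randomized form as sketched by Shor).
* E. Bernstein, U. Vazirani, *Quantum complexity theory*, SIAM J. Comput. 26 (1997), §8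
  (`BQP^BQP = BQP`, classical computation inside quantum machines).
* M. A. Nielsen, I. L. Chuang, *Quantum Computation and Quantum Information* (CUP 2010), §3.2.5
  and §4.5.5 (reversible simulation of classical circuits by quantum circuits), §5.3, App. A4.3.
  (Remark: Theorem A4.13 there states the reduction bound with `1 - 2^{-m}`; that constant is
  too strong — for `N = 21` exactly half of the units are bad — and Shor's `1 - 2^{-(k-1)}`,
  vendored here, is the correct printed statement.)
* G. H. Hardy, E. M. Wright, *An Introduction to the Theory of Numbers* (6th ed., OUP 2008),
  Thm 328 (`liminf φ(n) log log n / n = e^{-γ}`, §18.4), Ch. X (continued fractions).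

## Mathlib / tree

Used from Mathlib: `Nat.ModEq`, `Nat.gcd`, `Nat.Coprime.dvd_of_dvd_mul_left`,
`Nat.primeFactorsList` (`Nat.mem_primeFactorsList`, `Nat.minFac`), `ZMod`, `orderOf`,
`ZMod.equivPi` (CRT), `MulEquiv.piUnits`, `Units.mapEquiv`, `ZMod.isCyclic_units_of_prime_pow`,
`ZMod.card_units_eq_totient`, `Nat.totient_even`, `ZMod.neg_one_ne_one`,
`IsCyclic.card_pow_eq_one_le`, `padicValNat`, `Nat.exists_eq_two_pow_mul_odd`,
`Fintype.card_piFinset`, `Finset.card_eq_sum_card_image`, `Finset.card_le_mul_card_image`,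
`Nat.totient`, `Real.log`, `Complex.exp`, `PMF.toOuterMeasure_map_apply`,
`PMF.toOuterMeasure_apply`, `PMF.tsum_coe`, `List.singleton_prefix_cons_iff`, `List.ofFn_succ`,
`Real.exists_rat_eq_convergent` (Legendre; not restated). From the tree: `FACT`, `factSet`,
`encode_mem_FACT_iff` (`Factoring`), `IsQSolvable`, `FBQP`, `BQP`, `mem_BQP_iff`,
`QCircuitFamily.kernelProb/kernel/acceptProbOn`, `QCircuit.outputPMF/acceptProb/runOn`,
`QCircuit.outputPMF_apply`, `cliffordT_isUnitary` (`QuantumCircuit`, `QubitRegister`,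
`ClassBQP`), `FP`, `boolPair`, `boolUnpair`, `encodingListNatBool`, `Encoding.pairBool`,
`Encoding.listBool` (`Classes`, `BoolEncodings`), `isQSolvable_factoring` (`Shor`).

## Design choices

* Nothing in `Shor.lean` is restated or weakened; `FACT_mem_BQP` keeps its meaning. The
  assembly theorem takes the named facts as hypotheses `(h : X)`, per the tree's convention, so
  that discharging them (`X_holds`) later closes `FACT_mem_BQP` by one application.
* Decision from search goes through a Boolean-valued `bit : List Bool → Bool` with
  `bit x = true ↔ x ∈ L` rather than `decide`, to keep statements free of decidability
  instances on languages.
* `factPost` really parses the measured string: it decodes the input pair `(N, k)` from the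
  first component (checking that the input *is* the canonical encoding, since `FACT` is an image
  language), decodes the prime-factor list written by Shor's algorithm as a *prefix* of the
  second component (`Encoding.listBool` is self-delimiting: `listBool_decode_encode_append`),
  and compares; it does not recompute the factorization (which would turn `factPost_mem_FP`
  into the open statement `FACT ∈ P`). `N = 0` is special-cased (`(0, k) ∈ factSet ↔ 2 ≤ k`,
  every `d` divides `0`, while `Nat.primeFactorsList 0 = []`).
* `isQSolvable_classicalWrap` is stated for arbitrary relations `R` and arbitrary `FP`
  functions; no length-regularity of the pre-processor is assumed (the family for input length
  `n` carries one copy of the given family for every intermediate length `≤ poly n` and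
  multiplexes on the computed length), and the post-processor reads the input together with the
  full measured string through `boolPair`.
* Shor's `{a}_q` (residue in `(-q/2, q/2]`) is `Shor1997.symmMod`; the per-outcome probability
  (5.7)–(5.8) of the arXiv text is `Shor1997.outcomeProb`, stated with the finite geometric sum
  exactly as printed (upper summation index `⌊(q - k - 1)/r⌋`). The bound `1/3r²` is printed "for
  sufficiently large `n`"; the fact quantifies `∃ n₀`.
* The reduction bound is stated by counting units of `ZMod n` (uniform choice among units, as
  in the printed proof; a non-unit `x` yields the factor `gcd(x, n)` directly).
-/

noncomputable section

namespace Literature.Computability.Cryptography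

open _root_.Computability Nat Complexity

/-! ### Shor 1997 §5: arithmetic of the reduction to order finding -/

/-- **Shor's gcd criterion** (Shor 1997, §5, p. 13 of arXiv v2: "since
`(x^{r/2} - 1)(x^{r/2} + 1) = x^r - 1 ≡ 0 (mod n)`, the `gcd(x^{r/2} - 1, n)` fails to be a
non-trivial divisor of `n` only if `r` is odd or `x^{r/2} ≡ -1 (mod n)`"). Precisely: if `1 < n`,
`r` is even, `x ^ r ≡ 1`, `x ^ (r/2) ≢ 1` (automatic when `r` is the order of `x`) and
`x ^ (r/2) ≢ -1 (mod n)`, then `d = gcd (x ^ (r/2) - 1) n` satisfies `1 < d < n` (and `d ∣ n`).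
[cite: Shor1997, §5 (reduction to order finding)] -/
theorem Shor1997.one_lt_gcd_pow_half_sub_one {n x r : ℕ} (hn : 1 < n) (hr : Even r)
    (hxr : x ^ r ≡ 1 [MOD n]) (h1 : ¬ x ^ (r / 2) ≡ 1 [MOD n]) (h2 : ¬ n ∣ x ^ (r / 2) + 1) :
    1 < Nat.gcd (x ^ (r / 2) - 1) n ∧ Nat.gcd (x ^ (r / 2) - 1) n < n := by
  obtain ⟨s, rfl⟩ := hr
  have hs : (s + s) / 2 = s := by omega
  rw [hs] at h1 h2 ⊢
  set a := x ^ s with ha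
  have hxa : x ^ (s + s) = a * a := by rw [pow_add]
  rw [hxa] at hxr
  have hn0 : 0 < n := by omega
  have ha1 : 1 ≤ a := by
    rcases Nat.eq_zero_or_pos a with h0 | h0
    · exfalso
      rw [h0, mul_zero] at hxr
      have : n ≤ 1 := Nat.le_of_dvd one_pos (Nat.modEq_zero_iff_dvd.mp hxr.symm)
      omega
    · exact h0
  have hdvd : n ∣ (a - 1) * (a + 1) := by
    have h := (Nat.modEq_iff_dvd' (Nat.one_le_iff_ne_zero.mpr
      (Nat.mul_ne_zero (by omega) (by omega)))).mp hxr.symm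
    have heq : a * a - 1 = (a - 1) * (a + 1) := by
      clear_value a
      obtain ⟨b, rfl⟩ : ∃ b, a = b + 1 := ⟨a - 1, by omega⟩
      simp only [Nat.add_sub_cancel]
      rw [show (b + 1) * (b + 1) = b * (b + 1 + 1) + 1 by ring, Nat.add_sub_cancel]
    rwa [heq] at h
  refine ⟨?_, ?_⟩
  · have hpos : 0 < Nat.gcd (a - 1) n := Nat.gcd_pos_of_pos_right _ hn0
    rcases Nat.lt_or_ge 1 (Nat.gcd (a - 1) n) with h | h
    · exact h
    · exfalso
      have hcop : Nat.Coprime n (a - 1) := by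
        rw [Nat.coprime_comm]; exact le_antisymm h hpos
      exact h2 (hcop.dvd_of_dvd_mul_left hdvd)
  · rcases lt_or_eq_of_le (Nat.gcd_le_right (a - 1) hn0) with h | h
    · exact h
    · exfalso
      have hd : n ∣ a - 1 := h ▸ Nat.gcd_dvd_left (a - 1) n
      exact h1 ((Nat.modEq_iff_dvd' ha1).mpr hd).symm

/-- **Uniqueness of the approximant** (Shor 1997, §5, p. 14 of arXiv v2: "because `q > n²`,
there is at most one fraction `d/r` with `r < n` that satisfies `|c/q - d/r| ≤ 1/2q`"). Stated
for any real `ξ` in place of `c/q` and with the weaker hypothesis `n² ≤ q`: two fractions `d/r`,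
`d'/r'` with `0 < r, r' < n` both within `1/(2q)` of `ξ` are equal (`d r' = d' r`). The next
step of the printed proof, that this fraction is a continued-fraction convergent of `c/q`
(Hardy–Wright, Ch. X), is Mathlib's `Real.exists_rat_eq_convergent`.
[cite: Shor1997, §5 (order finding, uniqueness of d/r)] -/
theorem Shor1997.approximant_unique {n q r r' : ℕ} {d d' : ℤ} (hq : n ^ 2 ≤ q) (hr : 0 < r)
    (hrn : r < n) (hr' : 0 < r') (hrn' : r' < n) (ξ : ℝ)
    (h : |ξ - d / r| ≤ 1 / (2 * q)) (h' : |ξ - d' / r'| ≤ 1 / (2 * q)) :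
    d * r' = d' * r := by
  by_contra hne
  have hR : (0 : ℝ) < r := by exact_mod_cast hr
  have hR' : (0 : ℝ) < r' := by exact_mod_cast hr'
  have hn : (0 : ℝ) < n := by exact_mod_cast (lt_of_le_of_lt (Nat.zero_le _) hrn)
  have hQ : (n : ℝ) ^ 2 ≤ q := by exact_mod_cast hq
  have hQpos : (0 : ℝ) < q := lt_of_lt_of_le (by positivity) hQ
  have hone : (1 : ℝ) ≤ |((d * r' - d' * r : ℤ) : ℝ)| := by
    have : (1 : ℤ) ≤ |d * r' - d' * r| := Int.one_le_abs (sub_ne_zero.mpr hne)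
    rw [← Int.cast_abs]
    exact_mod_cast this
  have hdiff : (1 : ℝ) / (r * r') ≤ |(d : ℝ) / r - d' / r'| := by
    have hexpr : (d : ℝ) / r - d' / r' = ((d * r' - d' * r : ℤ) : ℝ) / (r * r') := by
      push_cast
      field_simp
    rw [hexpr, abs_div, abs_of_pos (mul_pos hR hR')]
    exact div_le_div_of_nonneg_right hone (by positivity)
  have htri : |(d : ℝ) / r - d' / r'| ≤ 1 / q := by
    calc |(d : ℝ) / r - d' / r'| = |(ξ - d' / r') - (ξ - d / r)| := by ring_nf
      _ ≤ |ξ - d' / r'| + |ξ - d / r| := abs_sub _ _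
      _ ≤ 1 / (2 * q) + 1 / (2 * q) := add_le_add h' h
      _ = 1 / q := by ring
  have hrr : (r : ℝ) * r' < n ^ 2 := by
    have h1 : (r : ℝ) < n := by exact_mod_cast hrn
    have h2 : (r' : ℝ) < n := by exact_mod_cast hrn'
    nlinarith
  have hlt : (1 : ℝ) / q < 1 / (r * r') :=
    lt_of_le_of_lt (one_div_le_one_div_of_le (by positivity) hQ)
      (one_div_lt_one_div_of_lt (by positivity) hrr)
  linarith

/-- **Miller's randomized reduction, success bound** (Shor 1997, §5, p. 13 of arXiv v2, after
Miller 1976: "this procedure, when applied to a random `x (mod n)`, yields a factor of `n` with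
probability at least `1 - 1/2^{k-1}`, where `k` is the number of distinct odd prime factors of
`n`"; the printed sketch chooses `x` among the units via the Chinese remainder theorem). Counting
form: for odd `n` with `k = |primeFactors n|`, the units `x` of `ZMod n` whose order `r` is odd
or satisfies `x ^ (r/2) = -1` number at most `|(ZMod n)ˣ| / 2^(k-1)`. (Trivial for `k ≤ 1`;
Nielsen–Chuang Thm A4.13 prints the constant `2^{-k}`, which fails for `n = 21`.)
[cite: Shor1997, §5 (reduction to order finding, probability 1 - 1/2^(k-1))] -/
def Shor1997_reduction_bound : Prop :=
  ∀ (n : ℕ) [NeZero n], Odd n →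
    (Finset.univ.filter fun x : (ZMod n)ˣ =>
        Odd (orderOf x) ∨ x ^ (orderOf x / 2) = -1).card * 2 ^ (n.primeFactors.card - 1) ≤
      Fintype.card (ZMod n)ˣ

/-! ### Discharge of `Shor1997_reduction_bound`

The printed sketch (Shor 1997, §5, p. 13 of arXiv v2): by the Chinese remainder theorem a unit
`x` mod `n = ∏ pᵢ^{aᵢ}` is a tuple `(xᵢ)` of units mod `pᵢ^{aᵢ}`; let `rᵢ` be the order of `xᵢ`
and `r = lcm rᵢ` the order of `x`. If `r` is odd, or `x^{r/2} ≡ -1`, then the largest powers of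
`2` dividing the `rᵢ` all agree (they are all `1`, resp. all equal to that of `r`, since
`xᵢ^{r/2} = -1 ≠ 1` forces `rᵢ ∤ r/2` while `rᵢ ∣ r`). Each unit group mod an odd prime power
is cyclic of even order, and in such a group at most half of the elements have order with any
prescribed 2-adic valuation; so all `k` valuations agree for at most a `2^{-(k-1)}` fraction of
the tuples. -/

namespace Shor1997

section ReductionBound

open Finset

/-! #### 2-adic valuations of orders -/

/-- `v₂(2^k m) = k` for odd `m` (`v₂ = padicValNat 2`). [folklore] -/
theorem padicValNat_two_pow_mul_odd (k : ℕ) {m : ℕ} (hm : Odd m) :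
    padicValNat 2 (2 ^ k * m) = k := by
  have hm0 : m ≠ 0 := by rintro rfl; exact Nat.not_odd_zero hm
  rw [padicValNat.mul (pow_ne_zero k two_ne_zero) hm0, padicValNat.prime_pow,
    padicValNat.eq_zero_of_not_dvd (fun h => (Nat.not_even_iff_odd.mpr hm) (even_iff_two_dvd.mpr h)),
    add_zero]

/-- If `a ∣ 2 b` but `a ∤ b` (`b ≠ 0`) then `v₂(a) = v₂(b) + 1` (the step "since `rᵢ ∣ r` and
`rᵢ ∤ r/2` we must have `dᵢ = d`" of the printed proof). [cite: Shor1997, §5 (reduction to order finding)] -/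
theorem padicValNat_two_eq_succ_of_dvd_two_mul {a b : ℕ} (hb : b ≠ 0) (h1 : a ∣ 2 * b)
    (h2 : ¬ a ∣ b) : padicValNat 2 a = padicValNat 2 b + 1 := by
  have ha : a ≠ 0 := by
    rintro rfl
    exact hb (by simpa using (zero_dvd_iff.mp h1))
  obtain ⟨α, a₁, ha₁, rfl⟩ := Nat.exists_eq_two_pow_mul_odd ha
  obtain ⟨β, b₁, hb₁, rfl⟩ := Nat.exists_eq_two_pow_mul_odd hb
  rw [padicValNat_two_pow_mul_odd α ha₁, padicValNat_two_pow_mul_odd β hb₁]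
  have h1' : 2 ^ α * a₁ ∣ 2 ^ (β + 1) * b₁ := by
    rw [pow_succ]; convert h1 using 1; ring
  -- `a₁ ∣ b₁`
  have hab : a₁ ∣ b₁ := by
    have : a₁ ∣ 2 ^ (β + 1) * b₁ := (Dvd.intro_left _ rfl).trans h1'
    exact (Nat.Coprime.pow_right _ (Nat.coprime_two_right.mpr ha₁)).dvd_of_dvd_mul_left this
  -- `α ≤ β + 1`
  have hle : α ≤ β + 1 := by
    have : 2 ^ α ∣ 2 ^ (β + 1) * b₁ := (Dvd.intro _ rfl).trans h1'
    have : 2 ^ α ∣ 2 ^ (β + 1) :=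
      (Nat.Coprime.pow_left _ (Nat.coprime_two_left.mpr hb₁)).dvd_of_dvd_mul_right this
    exact (Nat.pow_dvd_pow_iff_le_right one_lt_two).mp this
  -- and `α ≤ β` is impossible
  rcases Nat.lt_or_ge β α with h | h
  · omega
  · exfalso
    apply h2
    exact mul_dvd_mul (Nat.pow_dvd_pow 2 h) hab

/-- If `a ∣ 2^s m` with `m` odd then `a ∣ 2^{v₂(a)} m`. [folklore] -/
theorem dvd_two_pow_padicValNat_mul {a s m : ℕ} (hm : Odd m) (h : a ∣ 2 ^ s * m) :
    a ∣ 2 ^ padicValNat 2 a * m := by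
  have hm0 : m ≠ 0 := by rintro rfl; exact Nat.not_odd_zero hm
  have ha : a ≠ 0 := by
    rintro rfl
    exact (Nat.mul_ne_zero (pow_ne_zero s two_ne_zero) hm0) (zero_dvd_iff.mp h)
  obtain ⟨α, a₁, ha₁, rfl⟩ := Nat.exists_eq_two_pow_mul_odd ha
  rw [padicValNat_two_pow_mul_odd α ha₁]
  refine mul_dvd_mul_left _ ?_
  have : a₁ ∣ 2 ^ s * m := (Dvd.intro_left _ rfl).trans h
  exact (Nat.Coprime.pow_right _ (Nat.coprime_two_right.mpr ha₁)).dvd_of_dvd_mul_left this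

/-- `v₂` is monotone along divisibility. [folklore] -/
theorem padicValNat_two_le_of_dvd {a b : ℕ} (hb : b ≠ 0) (h : a ∣ b) :
    padicValNat 2 a ≤ padicValNat 2 b :=
  (padicValNat_dvd_iff_le hb).mp (pow_padicValNat_dvd.trans h)

/-! #### Cyclic groups of even order -/

section Cyclic

variable {G : Type*} [CommGroup G] [Fintype G] [DecidableEq G]

/-- The elements of a finite group whose order has 2-adic valuation exactly `j` (the "largest
power of `2` dividing `rᵢ`" classes of the printed proof). [cite: Shor1997, §5 (reduction to order finding)] -/
def valSet (G : Type*) [Group G] [Fintype G] (j : ℕ) : Finset G :=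
  univ.filter fun g => padicValNat 2 (orderOf g) = j

/-- In a finite cyclic group of even order `M = 2^s m` (`m` odd, `s ≥ 1`), for every `j` at
most half of the elements have order of 2-adic valuation exactly `j` (Shor: "the probability is
at most 1/2 of choosing an `xᵢ` having any particular power of two as the largest divisor of
its order"). Proof: for `j < s` such elements satisfy `g^{2^j m} = 1`, and a cyclic group has at
most `2^j m ≤ M/2` of those; for `j = s` they are non-squares, and at least half of the
elements are squares (the squaring map is at most 2-to-1); for `j > s` there are none.
[cite: Shor1997, §5 (reduction to order finding)] -/
theorem two_mul_card_valSet_le [IsCyclic G] (hG : Even (Fintype.card G)) (j : ℕ) :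
    2 * (valSet G j).card ≤ Fintype.card G := by
  classical
  set M := Fintype.card G with hM
  have hM0 : M ≠ 0 := Fintype.card_ne_zero
  obtain ⟨s, m, hm, hMeq⟩ := Nat.exists_eq_two_pow_mul_odd hM0
  have hs : 1 ≤ s := by
    rcases Nat.eq_zero_or_pos s with h | h
    · exfalso
      rw [h, pow_zero, one_mul] at hMeq
      rw [hMeq] at hG
      exact (Nat.not_even_iff_odd.mpr hm) hG
    · exact h
  have hvM : padicValNat 2 M = s := by rw [hMeq]; exact padicValNat_two_pow_mul_odd s hm
  have hm0 : m ≠ 0 := by rintro rfl; exact Nat.not_odd_zero hm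
  -- every order divides `M`
  have hord : ∀ g : G, orderOf g ∣ M := fun g => orderOf_dvd_card
  rcases lt_trichotomy j s with hj | hjs | hj
  · -- `j < s`: `valSet ⊆ {g | g ^ (2^j m) = 1}`, of size `≤ 2^j m ≤ M / 2`
    have hsub : valSet G j ⊆ univ.filter fun g : G => g ^ (2 ^ j * m) = 1 := by
      intro g hg
      simp only [valSet, mem_filter, mem_univ, true_and] at hg ⊢
      have := dvd_two_pow_padicValNat_mul hm (hMeq ▸ hord g)
      rw [hg] at this
      exact orderOf_dvd_iff_pow_eq_one.mp this
    calc 2 * (valSet G j).card ≤ 2 * (univ.filter fun g : G => g ^ (2 ^ j * m) = 1).card :=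
          Nat.mul_le_mul_left 2 (card_le_card hsub)
      _ ≤ 2 * (2 ^ j * m) := Nat.mul_le_mul_left 2
          (IsCyclic.card_pow_eq_one_le (Nat.mul_pos (pow_pos two_pos j)
            (Nat.pos_of_ne_zero hm0)))
      _ = 2 ^ (j + 1) * m := by ring
      _ ≤ 2 ^ s * m := Nat.mul_le_mul_right m (Nat.pow_le_pow_right two_pos hj)
      _ = M := hMeq.symm
  · -- `j = s`: `valSet` misses the squares, and there are `≥ M / 2` squares
    obtain rfl : s = j := hjs.symm
    have himage : (univ.image fun g : G => g ^ 2).card * 2 ≥ M := by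
      have hker : ∀ b ∈ univ.image (fun g : G => g ^ 2),
          (univ.filter fun g : G => g ^ 2 = b).card ≤ 2 := by
        intro b hb
        obtain ⟨g₀, -, rfl⟩ := mem_image.mp hb
        -- the fibre over `g₀²` is `g₀ * {h | h² = 1}`
        have : (univ.filter fun g : G => g ^ 2 = g₀ ^ 2) =
            (univ.filter fun h : G => h ^ 2 = 1).image (g₀ * ·) := by
          ext g
          simp only [mem_filter, mem_univ, true_and, mem_image]
          constructor
          · intro h
            refine ⟨g₀⁻¹ * g, ?_, by group⟩
            rw [mul_pow, inv_pow, h]; group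
          · rintro ⟨h, hh, rfl⟩
            rw [mul_pow, hh, mul_one]
        rw [this]
        exact card_image_le.trans (IsCyclic.card_pow_eq_one_le two_pos)
      have := card_le_mul_card_image (univ : Finset G) 2 hker
      simpa [hM, mul_comm] using this
    have hdisj : Disjoint (valSet G s) (univ.image fun g : G => g ^ 2) := by
      rw [disjoint_iff_ne]
      rintro a ha _ hb rfl
      simp only [valSet, mem_filter, mem_univ, true_and] at ha
      obtain ⟨g, -, rfl⟩ := mem_image.mp hb
      -- `v₂ (orderOf (g²)) < s`
      have hg := hord g
      rw [orderOf_pow' g two_ne_zero] at ha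
      rcases Nat.even_or_odd (orderOf g) with he | ho
      · have h2 : Nat.gcd (orderOf g) 2 = 2 := Nat.gcd_eq_right (even_iff_two_dvd.mp he)
        rw [h2] at ha
        have hv := padicValNat_two_le_of_dvd hM0 hg
        rw [hvM] at hv
        have hne : orderOf g / 2 ≠ 0 := by
          intro h0; rw [h0] at ha; simp at ha; omega
        have : padicValNat 2 (orderOf g) = padicValNat 2 (orderOf g / 2) + 1 := by
          conv_lhs => rw [← Nat.div_mul_cancel (even_iff_two_dvd.mp he), mul_comm]
          rw [padicValNat.mul two_ne_zero hne, padicValNat.self one_lt_two, add_comm]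
        omega
      · have h1 : Nat.gcd (orderOf g) 2 = 1 := Nat.coprime_two_right.mpr ho
        rw [h1, Nat.div_one, padicValNat.eq_zero_of_not_dvd
          (fun h => (Nat.not_even_iff_odd.mpr ho) (even_iff_two_dvd.mpr h))] at ha
        omega
    have := card_union_of_disjoint hdisj
    have hle : (valSet G s ∪ univ.image fun g : G => g ^ 2).card ≤ M := card_le_univ _
    omega
  · -- `j > s`: `valSet` is empty
    have : valSet G j = ∅ := by
      apply filter_eq_empty_iff.mpr
      intro g _ hg
      have hv := padicValNat_two_le_of_dvd hM0 (hord g)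
      rw [hvM, hg] at hv
      omega
    rw [this, card_empty, mul_zero]
    exact Nat.zero_le _

end Cyclic

/-! #### Counting tuples with equal labels -/

section Product

open Fintype in
/-- If in each finite type `G i` every label class `{g | d i g = j}` has at most half of the
elements, then the tuples all of whose components carry the same label are at most a
`2^{-(k-1)}` fraction of all tuples, `k` the number of indices (Shor: "each of these powers of
`2` has at most a 50% probability of agreeing with the previous ones, so all `k` of them agree
with probability at most `1/2^{k-1}`"). [cite: Shor1997, §5 (reduction to order finding)] -/
theorem card_filter_forall_eq_mul_two_pow_le {ι : Type*} [Fintype ι] [DecidableEq ι]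
    {G : ι → Type*} [∀ i, Fintype (G i)] [∀ i, DecidableEq (G i)] (d : ∀ i, G i → ℕ)
    (h : ∀ i j, 2 * (univ.filter fun g : G i => d i g = j).card ≤ Fintype.card (G i))
    (i₀ : ι) :
    (univ.filter fun x : (∀ i, G i) => ∀ i, d i (x i) = d i₀ (x i₀)).card *
        2 ^ (Fintype.card ι - 1) ≤ ∏ i, Fintype.card (G i) := by
  classical
  set S : ∀ i, ℕ → Finset (G i) := fun i j => univ.filter fun g : G i => d i g = j with hS
  set J : Finset ℕ := univ.image (d i₀) with hJ
  -- cover by the boxes `∏ S i j`, `j ∈ J`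
  have hcover : (univ.filter fun x : (∀ i, G i) => ∀ i, d i (x i) = d i₀ (x i₀)) ⊆
      J.biUnion fun j => Fintype.piFinset fun i => S i j := by
    intro x hx
    simp only [mem_filter, mem_univ, true_and] at hx
    simp only [mem_biUnion, Fintype.mem_piFinset, hJ, mem_image, mem_univ, true_and, hS,
      mem_filter]
    exact ⟨d i₀ (x i₀), ⟨x i₀, rfl⟩, fun i => hx i⟩
  have hk : Fintype.card ι - 1 = (univ.erase i₀).card := by
    rw [card_erase_of_mem (mem_univ i₀), Finset.card_univ]
  calc (univ.filter fun x : (∀ i, G i) => ∀ i, d i (x i) = d i₀ (x i₀)).card *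
        2 ^ (Fintype.card ι - 1)
      ≤ (J.biUnion fun j => Fintype.piFinset fun i => S i j).card * 2 ^ (Fintype.card ι - 1) :=
        Nat.mul_le_mul_right _ (card_le_card hcover)
    _ ≤ (∑ j ∈ J, (Fintype.piFinset fun i => S i j).card) * 2 ^ (Fintype.card ι - 1) :=
        Nat.mul_le_mul_right _ card_biUnion_le
    _ = ∑ j ∈ J, (S i₀ j).card * ∏ i ∈ univ.erase i₀, 2 * (S i j).card := by
        rw [sum_mul]
        refine sum_congr rfl fun j _ => ?_
        rw [Fintype.card_piFinset, ← mul_prod_erase univ (fun i => (S i j).card) (mem_univ i₀),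
          hk, ← prod_const, mul_assoc, ← prod_mul_distrib]
        simp_rw [mul_comm]
    _ ≤ ∑ j ∈ J, (S i₀ j).card * ∏ i ∈ univ.erase i₀, Fintype.card (G i) := by
        refine sum_le_sum fun j _ => Nat.mul_le_mul_left _ ?_
        exact prod_le_prod' fun i _ => h i j
    _ = (∑ j ∈ J, (S i₀ j).card) * ∏ i ∈ univ.erase i₀, Fintype.card (G i) := by
        rw [sum_mul]
    _ = Fintype.card (G i₀) * ∏ i ∈ univ.erase i₀, Fintype.card (G i) := by
        congr 1
        rw [← Finset.card_univ, card_eq_sum_card_image (d i₀) univ]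
    _ = ∏ i, Fintype.card (G i) := mul_prod_erase univ (fun i => Fintype.card (G i)) (mem_univ i₀)

end Product

/-! #### Transport to the units modulo `n` -/

section Transport

variable (n : ℕ)

/-- The prime-power components `pᵢ^{aᵢ}` of `n = ∏ pᵢ^{aᵢ}`, indexed by `n.primeFactors`.
[folklore] -/
abbrev PP (p : n.primeFactors) : ℕ := (p : ℕ) ^ n.factorization p

/-- The index primes are prime. [folklore] -/
theorem PP_prime (p : n.primeFactors) : (p : ℕ).Prime := Nat.prime_of_mem_primeFactors p.2

/-- The exponents `aᵢ` are positive (`n ≠ 0`). [folklore] -/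
theorem one_le_factorization [NeZero n] (p : n.primeFactors) : 1 ≤ n.factorization p :=
  (PP_prime n p).factorization_pos_of_dvd (NeZero.ne n) (Nat.dvd_of_mem_primeFactors p.2)

/-- The prime-power components are nonzero (so `ZMod (PP n p)` is finite); a new instance on
this file's own abbreviation, not overriding anything. [folklore] -/
instance neZero_PP (p : n.primeFactors) : NeZero (PP n p) :=
  ⟨pow_ne_zero _ (PP_prime n p).ne_zero⟩

/-- For odd `n`, every prime-power component exceeds `2` (so `-1 ≠ 1` modulo it and its unit
group has even order). [folklore] -/
theorem two_lt_PP [NeZero n] (hn : Odd n) (p : n.primeFactors) : 2 < PP n p := by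
  have hp := PP_prime n p
  have hp2 : (p : ℕ) ≠ 2 := by
    rintro h
    have : 2 ∣ n := h ▸ Nat.dvd_of_mem_primeFactors p.2
    exact (Nat.not_even_iff_odd.mpr hn) (even_iff_two_dvd.mpr this)
  have h3 : 3 ≤ (p : ℕ) := by
    have := hp.two_le
    omega
  calc 2 < 3 := by norm_num
    _ ≤ (p : ℕ) ^ 1 := by simpa using h3
    _ ≤ PP n p := Nat.pow_le_pow_right hp.pos (one_le_factorization n p)

/-- The Chinese remainder isomorphism on units,
`(ZMod n)ˣ ≃* ∏ᵢ (ZMod pᵢ^{aᵢ})ˣ` (Mathlib's `ZMod.equivPi` pushed through `Units.mapEquiv`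
and `MulEquiv.piUnits`); Shor: "choosing an `x (mod n)` at random is the same as choosing for
each `i` a number `xᵢ (mod pᵢ^{aᵢ})` at random" [Hardy–Wright Thm 121].
[cite: Shor1997, §5 (reduction to order finding, Chinese remainder theorem)] -/
def unitsEquivPi [NeZero n] : (ZMod n)ˣ ≃* ∀ p : n.primeFactors, (ZMod (PP n p))ˣ :=
  (Units.mapEquiv (ZMod.equivPi n (NeZero.ne n)).toMulEquiv).trans MulEquiv.piUnits

/-- The components of `unitsEquivPi` are the residues (definitional). [folklore] -/
theorem val_unitsEquivPi_apply [NeZero n] (x : (ZMod n)ˣ) (p : n.primeFactors) :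
    ((unitsEquivPi n x) p : ZMod (PP n p)) = ZMod.equivPi n (NeZero.ne n) (x : ZMod n) p := rfl

/-- `unitsEquivPi` maps `-1` to the tuple of `-1`'s. [folklore] -/
theorem unitsEquivPi_neg_one [NeZero n] (p : n.primeFactors) : unitsEquivPi n (-1) p = -1 := by
  ext
  rw [val_unitsEquivPi_apply, Units.val_neg, Units.val_one, map_neg, map_one]
  rfl

end Transport

/-- **Miller's reduction bound, proved** (the statement of `Shor1997_reduction_bound` with
its binders): for odd `n` with `k` distinct prime factors, the units `x` mod `n` with odd order
`r` or with `x^{r/2} = -1` are at most `|(ZMod n)ˣ| / 2^{k-1}` in number. Bad units map under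
`unitsEquivPi` into the tuples whose components' orders share one 2-adic valuation
(`padicValNat_two_eq_succ_of_dvd_two_mul`, `ZMod.neg_one_ne_one`), which are counted by
`card_filter_forall_eq_mul_two_pow_le` and `two_mul_card_valSet_le`
(`ZMod.isCyclic_units_of_prime_pow`, `Nat.totient_even`).
[cite: Shor1997, §5 (reduction to order finding, probability 1 - 1/2^(k-1))] -/
theorem reduction_bound (n : ℕ) [NeZero n] (hn : Odd n) :
    (Finset.univ.filter fun x : (ZMod n)ˣ =>
        Odd (orderOf x) ∨ x ^ (orderOf x / 2) = -1).card * 2 ^ (n.primeFactors.card - 1) ≤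
      Fintype.card (ZMod n)ˣ := by
  -- `n = 1`: no prime factors, trivial
  rcases (n.primeFactors).eq_empty_or_nonempty with h0 | ⟨p₀, hp₀⟩
  · rw [h0, card_empty, Nat.zero_sub, pow_zero, mul_one]
    exact card_filter_le _ _
  have hp2 : ∀ p : n.primeFactors, ((p : ℕ)) ≠ 2 := by
    rintro p h
    have : 2 ∣ n := h ▸ Nat.dvd_of_mem_primeFactors p.2
    exact (Nat.not_even_iff_odd.mpr hn) (even_iff_two_dvd.mpr this)
  have hhalf : ∀ (p : n.primeFactors) (j : ℕ),
      2 * (univ.filter fun g : (ZMod (PP n p))ˣ => padicValNat 2 (orderOf g) = j).card ≤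
        Fintype.card (ZMod (PP n p))ˣ := by
    intro p j
    haveI : IsCyclic (ZMod (PP n p))ˣ :=
      ZMod.isCyclic_units_of_prime_pow p (PP_prime n p) (hp2 p) _
    have heven : Even (Fintype.card (ZMod (PP n p))ˣ) := by
      rw [ZMod.card_units_eq_totient]
      exact Nat.totient_even (two_lt_PP n hn p)
    exact two_mul_card_valSet_le heven j
  -- every bad unit has components whose orders share one 2-adic valuation
  have hmap : ∀ x : (ZMod n)ˣ, (Odd (orderOf x) ∨ x ^ (orderOf x / 2) = -1) →
      ∃ c, ∀ p, padicValNat 2 (orderOf (unitsEquivPi n x p)) = c := by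
    intro x hx
    have hdvd : ∀ p, orderOf (unitsEquivPi n x p) ∣ orderOf x := fun p => by
      rw [← MulEquiv.orderOf_eq (unitsEquivPi n) x]
      have := orderOf_map_dvd
        (Pi.evalMonoidHom (fun q : n.primeFactors => (ZMod (PP n q))ˣ) p) (unitsEquivPi n x)
      rwa [Pi.evalMonoidHom_apply] at this
    by_cases hodd : Odd (orderOf x)
    · refine ⟨0, fun p => ?_⟩
      exact padicValNat.eq_zero_of_not_dvd fun h2 =>
        (Nat.not_even_iff_odd.mpr (hodd.of_dvd_nat (hdvd p))) (even_iff_two_dvd.mpr h2)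
    · have hx' : x ^ (orderOf x / 2) = -1 := hx.resolve_left hodd
      have heven : Even (orderOf x) := Nat.not_odd_iff_even.mp hodd
      have hr : orderOf x = 2 * (orderOf x / 2) := (Nat.two_mul_div_two_of_even heven).symm
      have hr₂0 : orderOf x / 2 ≠ 0 := by
        intro h0
        have := orderOf_pos x
        omega
      refine ⟨padicValNat 2 (orderOf x / 2) + 1, fun p => ?_⟩
      apply padicValNat_two_eq_succ_of_dvd_two_mul hr₂0
      · rw [← hr]; exact hdvd p
      · intro hd
        have h1 : (unitsEquivPi n x p) ^ (orderOf x / 2) = 1 := orderOf_dvd_iff_pow_eq_one.mp hd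
        have h2 : (unitsEquivPi n x p) ^ (orderOf x / 2) = -1 := by
          rw [← Pi.pow_apply, ← map_pow, hx']
          exact unitsEquivPi_neg_one n p
        rw [h1] at h2
        haveI : Fact (2 < PP n p) := ⟨two_lt_PP n hn p⟩
        exact ZMod.neg_one_ne_one (n := PP n p) (Units.ext_iff.mp h2).symm
  -- hence the bad units inject into the equal-label tuples
  have hcard : (Finset.univ.filter fun x : (ZMod n)ˣ =>
        Odd (orderOf x) ∨ x ^ (orderOf x / 2) = -1).card ≤
      (univ.filter fun y : (∀ p : n.primeFactors, (ZMod (PP n p))ˣ) =>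
        ∀ p, padicValNat 2 (orderOf (y p)) = padicValNat 2 (orderOf (y ⟨p₀, hp₀⟩))).card := by
    rw [← card_image_of_injective _ (unitsEquivPi n).injective]
    refine card_le_card (image_subset_iff.mpr fun x hx => ?_)
    simp only [mem_filter, mem_univ, true_and] at hx ⊢
    obtain ⟨c, hc⟩ := hmap x hx
    intro p
    rw [hc, hc]
  have hk : n.primeFactors.card = Fintype.card n.primeFactors := (Fintype.card_coe _).symm
  refine le_trans (Nat.mul_le_mul_right _ hcard) ?_
  rw [hk, Fintype.card_congr (unitsEquivPi n).toEquiv, Fintype.card_pi]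
  exact card_filter_forall_eq_mul_two_pow_le
    (fun (p : n.primeFactors) (y : (ZMod (PP n p))ˣ) => padicValNat 2 (orderOf y)) hhalf ⟨p₀, hp₀⟩

end ReductionBound

end Shor1997

/-- **Discharge of Miller's reduction bound** `Shor1997_reduction_bound` (Shor 1997, §5;
Miller 1976): proved from Mathlib's Chinese remainder theorem for `ZMod`, the cyclicity of the
units modulo odd prime powers, and the valuation count `Shor1997.two_mul_card_valSet_le`.
[cite: Shor1997, §5 (reduction to order finding, probability 1 - 1/2^(k-1))] -/
theorem Shor1997_reduction_bound_holds : Shor1997_reduction_bound :=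
  fun n _ hn => Shor1997.reduction_bound n hn

/-- Shor's symmetric residue `{a}_q`: the representative of `a (mod q)` in the range
`-q/2 < {a}_q ≤ q/2` (Shor 1997, §5, p. 14 of arXiv v2). For `q = 0` the value is `a` (junk,
`a % 0 = a`). [cite: Shor1997, §5 (definition of {rc}_q)] -/
def Shor1997.symmMod (a : ℤ) (q : ℕ) : ℤ :=
  if 2 * (a % q) > q then a % q - q else a % q

/-- Shor's per-outcome probability in the order-finding experiment (Shor 1997, §5, p. 14 of
arXiv v2, the displayed expression after "this leaves us with the expression"): with `q` the
transform size, `r` the order, `0 ≤ k < r` and `c` the observed value,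
`P(c, k) = |(1/q) ∑_{b=0}^{⌊(q-k-1)/r⌋} exp(2πi b {rc}_q / q)|²`, the probability of observing
`|c, x^k mod n⟩`. [cite: Shor1997, §5 (probability of observing |c, x^k mod n>)] -/
def Shor1997.outcomeProb (q r k c : ℕ) : ℝ :=
  ‖(1 / (q : ℂ)) * ∑ b ∈ Finset.range ((q - k - 1) / r + 1),
      Complex.exp (2 * Real.pi * Complex.I * (b : ℂ) * (Shor1997.symmMod (r * c) q : ℂ) /
        (q : ℂ))‖ ^ 2

/-- **Shor's exponential-sum estimate** (Shor 1997, §5, p. 14 of arXiv v2: "the probability of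
seeing a given state `|c, x^k (mod n)⟩` will thus be at least `1/3r²` if `-r/2 ≤ {rc}_q ≤ r/2`",
"for sufficiently large `n`"). With Shor's standing hypotheses: `q` the power of two with
`n² ≤ q < 2n²`, `0 < r < n` (the order of a unit mod `n`), `0 ≤ k < r`, `0 ≤ c < q`.
[cite: Shor1997, §5 (bound 1/3r^2 for |{rc}_q| ≤ r/2)] -/
def Shor1997_outcomeProb_lower_bound : Prop :=
  ∃ n₀ : ℕ, ∀ n q r k c : ℕ, n₀ ≤ n → n ^ 2 ≤ q → q < 2 * n ^ 2 → (∃ l : ℕ, q = 2 ^ l) →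
    0 < r → r < n → k < r → c < q → 2 * |Shor1997.symmMod (r * c) q| ≤ r →
      1 / (3 * (r : ℝ) ^ 2) ≤ Shor1997.outcomeProb q r k c

/-- **Totient lower bound used by Shor** (Shor 1997, §5, p. 14 of arXiv v2: "using the theorem
that `φ(r)/r > δ / log log r` for some constant `δ` [Hardy and Wright 1979, Theorem 328]";
Hardy–Wright Thm 328 is `liminf φ(n) log log n / n = e^{-γ}`). Stated for `r ≥ 3` (where
`log log r > 0`). [cite: HardyWright2008, Thm 328 (§18.4); as used in Shor1997 §5] -/
def Shor1997_totient_lower_bound : Prop :=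
  ∃ δ : ℝ, 0 < δ ∧ ∀ r : ℕ, 3 ≤ r → δ / Real.log (Real.log r) < (Nat.totient r : ℝ) / r

/-- The Boolean input encoding of an order-finding instance `(x, n)`: the pair encoding
`⟨x, n⟩` of the binary encodings (as for `FACT`). [Shor 1997, §5] [cite: Shor1997, §5 (order finding, input x and n)] -/
def encodeOrderInstance (x n : ℕ) : List Bool :=
  (encodingNatBool.pairBool encodingNatBool).encode (x, n)

/-- **Shor's order-finding theorem** (Shor 1997, §5, pp. 13–15 of arXiv v2, with §3 (reversible
modular exponentiation) and §4 (the transform `A_q`)): the order of a unit `x` modulo `n` is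
computable in bounded-error quantum polynomial time. FBQP form over the tree's model: some
poly-time uniform, oracle-free Clifford+T family, run on the encoding of `(x, n)` with `1 < n`
and `gcd(x, n) = 1` and measured on all wires, outputs with probability `≥ 2/3` a string whose
prefix is the binary encoding of `orderOf (x : ZMod n)` (the least `r > 0` with
`x ^ r ≡ 1 (mod n)`); the `2/3` is the amplified form of the printed `δ / log log r` per run
(repeat `O(log log r)` times, keep the least candidate `r'` with `x ^ r' ≡ 1`). Nothing is
required off the promise. [cite: Shor1997, §5 (quantum algorithm for order finding)] -/
def Shor1997_orderFinding_isQSolvable : Prop :=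
  IsQSolvable fun w => {y | ∀ x n : ℕ, w = encodeOrderInstance x n → 1 < n → x.Coprime n →
    encodeNat (orderOf (x : ZMod n)) <+: y}

/-! ### Search solvability: monotonicity and classical wrapping -/

/-- Search solvability (unrelativised) is monotone in the relation. Deliberate dot-notation
extension of `Literature.Computability.Cryptography.IsQSolvable` (cf. `IsQSolvableRel.mono`).
[Aaronson 2010, §1] [folklore] -/
theorem IsQSolvable.mono {R S : List Bool → Set (List Bool)}
    (h : IsQSolvable R) (hRS : ∀ x, R x ⊆ S x) : IsQSolvable S := by
  obtain ⟨F, hF, hU, hR⟩ := h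
  refine ⟨F, hF, hU, fun x => le_trans (hR x) ?_⟩
  refine ENNReal.toReal_mono (ne_top_of_le_ne_top ENNReal.one_ne_top ?_)
    ((F.kernel 0 x).toOuterMeasure_mono ((Set.inter_subset_left).trans (hRS x)))
  rw [← ((F.kernel 0 x).toOuterMeasure_apply_eq_one_iff Set.univ).2 (Set.subset_univ _)]
  exact (F.kernel 0 x).toOuterMeasure_mono (Set.inter_subset_left.trans (Set.subset_univ _))

/-- **Classical pre- and post-processing inside bounded-error quantum search** (the circuit
form of "deterministic polynomial-time computation is free inside `BQP`": Bernstein–Vazirani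
1997, §8; Nielsen–Chuang §3.2.5, §4.5.5). If the search problem `R` is solvable in
bounded-error quantum polynomial time and `h, g ∈ FP`, then so is the wrapped problem "on input
`x`, output (a string with prefix) `g ⟨x, y⟩` for some `y ∈ R (h x)`": the new family computes
`h x` reversibly, runs (a copy, selected by `|h x|`, of) the given family on `|h x⟩|0…0⟩`,
computes `g` reversibly on the input and all wires of that copy into fresh wires swapped to the
front, and is again poly-time uniform; by the principle of deferred measurement its output has
the required prefix whenever the simulated measurement lands in `R (h x)`, i.e. with
probability `≥ 2/3`. [cite: BernsteinVazirani1997, §8 (BQP^BQP = BQP; classical computation inside quantum machines)] -/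
def isQSolvable_classicalWrap : Prop :=
  ∀ (h g : List Bool → List Bool) {R : List Bool → Set (List Bool)},
    h ∈ FP → g ∈ FP → IsQSolvable R →
      IsQSolvable fun x => {z | ∃ y ∈ R (h x), g (boolPair x y) <+: z}

/-! ### Decision from search -/

section Decision


variable {N : ℕ}

/-- A singleton `[b]` is a prefix of the read-out `List.ofFn y` of a register iff the register
is nonempty and its wire `0` reads `b`. [folklore] -/
theorem singleton_isPrefix_ofFn_iff (b : Bool) (y : QReg N) :
    [b] <+: List.ofFn y ↔ ∃ h : 0 < N, y ⟨0, h⟩ = b := by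
  cases N with
  | zero => simp
  | succ k =>
    rw [List.ofFn_succ, List.singleton_prefix_cons_iff]
    constructor
    · intro h; exact ⟨Nat.succ_pos k, h.symm⟩
    · rintro ⟨_, h⟩; exact h.symm

/-- The squared-amplitude mass of the basis outcomes whose wire `0` reads `b` (zero on the
empty register). (Nielsen–Chuang §2.2.5, Born rule for a one-wire measurement.) [folklore] -/
def wireZeroMass (ψ : QReg N → ℂ) (b : Bool) : ℝ :=
  ∑ y : QReg N, if ∃ h : 0 < N, y ⟨0, h⟩ = b then ‖ψ y‖ ^ 2 else 0

/-- Over Clifford+T (unitary), the probability that the classical output of a circuit run on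
`|x⟩|0^m⟩` has prefix `[b]` is the Born mass of "wire `0` reads `b`". [folklore] -/
theorem toReal_outputPMF_map_singleton_prefix {n m : ℕ}
    (hout : @QCircuit.outputPMF_apply cliffordT n m) (hU : cliffordT_isUnitary)
    (C : QCircuit cliffordT (n + m)) (x : QReg n) (b : Bool) :
    (((C.outputPMF 0 x).map List.ofFn).toOuterMeasure {z | [b] <+: z}).toReal
      = wireZeroMass (C.runOn 0 (basisState (padInput x m))) b := by
  rw [PMF.toOuterMeasure_map_apply, PMF.toOuterMeasure_apply, tsum_fintype, wireZeroMass,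
    ENNReal.toReal_sum (fun y _ => ?_)]
  · refine Finset.sum_congr rfl fun y _ => ?_
    simp only [Set.indicator, Set.mem_preimage, Set.mem_setOf_eq, singleton_isPrefix_ofFn_iff]
    split_ifs with h
    · rw [hout hU, ENNReal.toReal_ofReal (sq_nonneg _)]
    · rfl
  · simp only [Set.indicator]
    split_ifs
    · rw [hout hU]; exact ENNReal.ofReal_ne_top
    · exact ENNReal.zero_ne_top

/-- Over Clifford+T (unitary), on a nonempty register the Born masses of "wire `0` reads
`true`" and "wire `0` reads `false`" add up to `1`. [folklore] -/
theorem wireZeroMass_true_add_false {n m : ℕ}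
    (hout : @QCircuit.outputPMF_apply cliffordT n m) (hU : cliffordT_isUnitary)
    (C : QCircuit cliffordT (n + m)) (x : QReg n) (hN : 0 < n + m) :
    wireZeroMass (C.runOn 0 (basisState (padInput x m))) true +
      wireZeroMass (C.runOn 0 (basisState (padInput x m))) false = 1 := by
  set ψ := C.runOn 0 (basisState (padInput x m))
  have htot : ∑ y : QReg (n + m), ‖ψ y‖ ^ 2 = 1 := by
    have h1 := (C.outputPMF 0 x).tsum_coe
    rw [tsum_fintype] at h1
    have h2 : ∑ y : QReg (n + m), ENNReal.ofReal (‖ψ y‖ ^ 2) = 1 := by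
      rw [← h1]; exact Finset.sum_congr rfl fun y _ => (hout hU 0 C x y).symm
    have h3 := congrArg ENNReal.toReal h2
    rwa [ENNReal.toReal_sum (fun _ _ => ENNReal.ofReal_ne_top), ENNReal.toReal_one,
      Finset.sum_congr rfl fun y _ => ENNReal.toReal_ofReal (sq_nonneg (‖ψ y‖))] at h3
  rw [wireZeroMass, wireZeroMass, ← Finset.sum_add_distrib, ← htot]
  refine Finset.sum_congr rfl fun y _ => ?_
  cases hy : y ⟨0, hN⟩ <;> simp [hy, hN]

/-- The acceptance probability of a circuit is the Born mass of "wire `0` reads `true`".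
[folklore] -/
theorem acceptProb_eq_wireZeroMass {G : QGateSet} {n m : ℕ} (C : QCircuit G (n + m))
    (x : QReg n) :
    C.acceptProb 0 x = wireZeroMass (C.runOn 0 (basisState (padInput x m))) true := by
  unfold QCircuit.acceptProb wireZeroMass
  refine Finset.sum_congr rfl fun y _ => ?_
  by_cases h : 0 < n + m
  · simp [h]
  · simp [h]

/-- **Decision from search.** If some poly-time uniform, oracle-free Clifford+T family, run on
`|x⟩|0…0⟩` and measured on all wires, writes the bit `bit x = [x ∈ L]` on wire `0` with
probability `≥ 2/3` (i.e. `x ↦ [bit x]` is in `FBQP`), then `L ∈ BQP`: the same family, read on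
wire `0` only, accepts members with probability `≥ 2/3` and non-members with probability
`≤ 1 - 2/3 = 1/3` (unitarity: the Born masses sum to `1`). Hypotheses: the named facts
`QCircuit.outputPMF_apply` and `cliffordT_isUnitary` of the tree. (Watrous 2009, §III.1;
Bernstein–Vazirani 1997, Def. 8.) [folklore] -/
theorem mem_BQP_of_isQSolvable_bit
    (hout : ∀ n m, @QCircuit.outputPMF_apply cliffordT n m) (hU : cliffordT_isUnitary)
    {L : Language Bool} {bit : List Bool → Bool} (hbit : ∀ x, bit x = true ↔ x ∈ L)
    (h : IsQSolvable fun x => {z | [bit x] <+: z}) : L ∈ BQP := by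
  obtain ⟨F, hF, hUnif, hR⟩ := h
  rw [Literature.Computability.Cryptography.ClassBQP.mem_BQP_iff]
  refine ⟨F, hF, hUnif, fun x => ?_⟩
  have key := fun b : Bool => toReal_outputPMF_map_singleton_prefix
    (hout x.length (F.ancillas x.length)) hU (F.circ x.length) x.get b
  have hx := hR x
  simp only [QCircuitFamily.kernelProb, QCircuitFamily.kernel] at hx
  have hpos : 0 < x.length + F.ancillas x.length := by
    by_contra h0
    rw [key, wireZeroMass] at hx
    have : ∑ y : QReg (x.length + F.ancillas x.length),
        (if ∃ h : 0 < x.length + F.ancillas x.length, y ⟨0, h⟩ = bit x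
          then ‖(F.circ x.length).runOn 0 (basisState (padInput x.get _)) y‖ ^ 2 else 0) = 0 :=
      Finset.sum_eq_zero fun y _ => by
        rw [if_neg]; rintro ⟨h, _⟩; omega
    rw [this] at hx; norm_num at hx
  constructor
  · intro hxL
    rw [(hbit x).2 hxL, key] at hx
    rw [QCircuitFamily.acceptProbOn, acceptProb_eq_wireZeroMass]
    exact hx
  · intro hxL
    have hb : bit x = false := by rw [Bool.eq_false_iff, Ne, hbit]; exact hxL
    rw [hb, key] at hx
    rw [QCircuitFamily.acceptProbOn, acceptProb_eq_wireZeroMass]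
    have := wireZeroMass_true_add_false (hout _ _) hU (F.circ x.length) x.get hpos
    linarith

end Decision

/-! ### The classical processors of the decision version -/

/-- The Boolean pair encoding of `ℕ × ℕ` used by `FACT` (`boolPair` of binary encodings).
[Arora–Barak 2009, §0.1] [folklore] -/
abbrev natPairEncoding : Encoding (ℕ × ℕ) Bool := encodingNatBool.pairBool encodingNatBool

/-- The classical pre-processor of the decision version: from (an encoding of) `⟨N, k⟩` to the
binary encoding of `N`, the input of Shor's algorithm. (`Encoding.pairBool`'s decoder is
total on `ℕ × ℕ`, so the `none` branch is dead; it is kept for robustness of the statement.)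
[Arora–Barak 2009, Example 2.3 (search vs decision for factoring)] [folklore] -/
def factPre (x : List Bool) : List Bool :=
  match natPairEncoding.decode x with
  | none => []
  | some p => encodeNat p.1

/-- The answer of the decision version from the data: `N`, the bound `k`, and the list `L` of
prime factors of `N`: for `N = 0` every `d` divides `N`, so the answer is `2 ≤ k`; otherwise
`N` has a divisor `1 < d ≤ k` iff some prime factor is `≤ k`. [Arora–Barak 2009, Example 2.3]
[folklore] -/
def factAnswer (N k : ℕ) (L : List ℕ) : Bool :=
  if N = 0 then decide (2 ≤ k) else decide (∃ p ∈ L, p ≤ k)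

/-- The classical post-processor of the decision version. Input `⟨x, y⟩` (`boolPair`), where
`x` is the instance and `y` the measured output string of Shor's algorithm run on `factPre x`;
output one bit: decode `x` as `⟨N, k⟩` and check that `x` is the *canonical* encoding (else
`x ∉ FACT`: answer `false`), decode the prime-factor list `L` that prefixes `y`
(`Encoding.listBool` is self-delimiting), and answer `factAnswer N k L`.
[Arora–Barak 2009, Example 2.3] [folklore] -/
def factPost (z : List Bool) : List Bool :=
  match natPairEncoding.decode (boolUnpair z).1 with
  | none => [false]
  | some p =>
    if natPairEncoding.encode p = (boolUnpair z).1 then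
      match encodingListNatBool.decode (boolUnpair z).2 with
      | none => [false]
      | some L => [factAnswer p.1 p.2 L]
    else [false]

/-- The membership bit of `FACT`, computed from the instance alone (by factoring; used only in
statements and proofs, never claimed to be polynomial time). [Arora–Barak 2009, Example 2.3]
[folklore] -/
def factBit (x : List Bool) : Bool :=
  match natPairEncoding.decode x with
  | none => false
  | some p => decide (natPairEncoding.encode p = x) && factAnswer p.1 p.2 p.1.primeFactorsList

/-- **Programming fact**: the pre-processor `factPre` (unpair, copy the first component) is
polynomial-time computable. [Arora–Barak 2009, §0.1, §1.2 (pairing and projections)] [folklore] -/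
def factPre_mem_FP : Prop :=
  factPre ∈ FP

/-- **Programming fact**: the post-processor `factPost` (unpair; decode, re-encode and compare
the instance; parse the self-delimited list prefix; compare its entries with `k`) is
polynomial-time computable. [Arora–Barak 2009, §0.1, §1.2, Example 2.3] [folklore] -/
def factPost_mem_FP : Prop :=
  factPost ∈ FP

/-- `boolPair` is associative with respect to appending to its second component (the second
component is copied verbatim at the end). [Arora–Barak 2009, §0.1] [folklore] -/
theorem boolPair_append (a y w : List Bool) : boolPair a y ++ w = boolPair a (y ++ w) := by
  simp [boolPair, List.append_assoc]

/-- **`Encoding.listBool` is self-delimiting**: decoding an encoded list of naturals followed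
by arbitrary garbage returns the list. [Arora–Barak 2009, §0.1 (self-delimiting tuples)]
[folklore] -/
theorem listBool_decode_encode_append (l : List ℕ) (w : List Bool) :
    encodingListNatBool.decode (encodingListNatBool.encode l ++ w) = some l := by
  simp only [encodingListNatBool, Computability.Encoding.listBool, boolPair_append,
    boolUnpair_boolPair, unary_decode_encode_nat]
  induction l with
  | nil => rfl
  | cons a l ih =>
    simp only [List.foldr_cons, List.length_cons, boolPair_append, listBoolDecode,
      boolUnpair_boolPair, encodingNatBool.decode_encode, ih]
    rfl

/-- `factAnswer` on the true prime-factor list decides `factSet`. [Arora–Barak 2009,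
Example 2.3] [folklore] -/
theorem factAnswer_primeFactorsList_iff (N k : ℕ) :
    factAnswer N k N.primeFactorsList = true ↔ (N, k) ∈ QuantumComplexity.factSet := by
  rw [QuantumComplexity.mem_factSet_iff, factAnswer]
  split_ifs with hN
  · subst hN
    simp only [decide_eq_true_eq]
    constructor
    · intro hk; exact ⟨2, by omega, hk, dvd_zero 2⟩
    · rintro ⟨d, hd1, hdk, -⟩; omega
  · simp only [decide_eq_true_eq]
    constructor
    · rintro ⟨p, hp, hpk⟩
      exact ⟨p, (Nat.prime_of_mem_primeFactorsList hp).one_lt, hpk,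
        Nat.dvd_of_mem_primeFactorsList hp⟩
    · rintro ⟨d, hd1, hdk, hdN⟩
      refine ⟨d.minFac, ?_, (Nat.minFac_le (by omega)).trans hdk⟩
      exact (Nat.mem_primeFactorsList hN).2
        ⟨Nat.minFac_prime (by omega), (Nat.minFac_dvd d).trans hdN⟩

/-- `factBit` is the membership bit of `FACT`. [Arora–Barak 2009, Example 2.3] [folklore] -/
theorem factBit_eq_true_iff (x : List Bool) : factBit x = true ↔ x ∈ QuantumComplexity.FACT := by
  change _ ↔ x ∈ natPairEncoding.encode '' QuantumComplexity.factSet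
  rw [Set.mem_image]
  constructor
  · intro h
    unfold factBit at h
    split at h
    · exact absurd h Bool.false_ne_true
    · rename_i p hp
      rw [Bool.and_eq_true, decide_eq_true_eq] at h
      exact ⟨p, (factAnswer_primeFactorsList_iff p.1 p.2).1 h.2, h.1⟩
  · rintro ⟨p, hp, rfl⟩
    unfold factBit
    rw [natPairEncoding.decode_encode]
    simp only [decide_true, Bool.true_and]
    exact (factAnswer_primeFactorsList_iff p.1 p.2).2 hp

/-- **Correctness of the post-processor.** If `y` carries as a prefix the encoded prime-factor
list of the number Shor's algorithm was run on (`decodeNat (factPre x)`), then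
`factPost ⟨x, y⟩ = [factBit x]`. [Arora–Barak 2009, Example 2.3] [folklore] -/
theorem factPost_boolPair (x y : List Bool)
    (hy : encodingListNatBool.encode (decodeNat (factPre x)).primeFactorsList <+: y) :
    factPost (boolPair x y) = [factBit x] := by
  obtain ⟨w, rfl⟩ := hy
  unfold factPost factBit factPre
  simp only [boolUnpair_boolPair]
  split
  · rfl
  · rename_i p hp
    by_cases hx : natPairEncoding.encode p = x
    · simp only [hx, if_true, decide_true, Bool.true_and, decode_encodeNat,
        listBool_decode_encode_append]
    · simp [hx]

/-! ### Assembly -/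

/-- **Assembly of Shor's theorem, decision form.** `FACT ∈ BQP` follows from: unitarity of
Clifford+T in the form of the named facts `QCircuit.outputPMF_apply` and `cliffordT_isUnitary`;
closure of bounded-error quantum search under classical `FP` pre- and post-processing
(`isQSolvable_classicalWrap`); the two programming facts `factPre_mem_FP`, `factPost_mem_FP`;
and Shor's theorem in FBQP form `isQSolvable_factoring` (Shor 1997, §5). Proof: wrap Shor's
family with `factPre`/`factPost`, observe (`factPost_boolPair`, `factBit_eq_true_iff`) that the
wrapped family writes the bit `[x ∈ FACT]` first, and read wire `0`
(`mem_BQP_of_isQSolvable_bit`). [cite: Shor1997, §5 (factoring in BQP, decision form)] -/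
theorem FACT_mem_BQP_of (hout : ∀ n m, @QCircuit.outputPMF_apply cliffordT n m)
    (hU : cliffordT_isUnitary) (hwrap : isQSolvable_classicalWrap) (hpre : factPre_mem_FP)
    (hpost : factPost_mem_FP) (hShor : isQSolvable_factoring) : FACT_mem_BQP := by
  have h1 := hwrap factPre factPost hpre hpost hShor
  have h2 : IsQSolvable fun x => {z | [factBit x] <+: z} := by
    refine h1.mono fun x z hz => ?_
    obtain ⟨y, hy, hz⟩ := hz
    rw [factPost_boolPair x y hy] at hz
    exact hz
  exact mem_BQP_of_isQSolvable_bit hout hU factBit_eq_true_iff h2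

/-! ### Discrete logarithms: every instance has exactly one solution -/

section DLog

/-- **Discharge of `existsUnique_mem_dlogSolutions`.** For a prime `p`, a generator `g` of
`ℤ_p^*` (order `p - 1`) and a unit `y`, there is exactly one `a < p - 1` with `g^a ≡ y (mod p)`:
the powers `g^0, …, g^{p-2}` are pairwise distinct and exhaust the `p - 1` units. (The same
argument, in `ℕ`/`Nat.ModEq` clothing, is `IsDLogInstance.existsUnique_mem_dlogSolutions` of
`BlumMicaliReduction.lean`; repeated here to keep this file's imports free of the Blum–Micali
material.) [Shor 1997, §6 (discrete logarithms: "find `r`, `0 ≤ r < p - 1`, with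
`g^r ≡ x (mod p)`"); Kranakis 1986, §1.13 (indices)] [cite: Shor1997, §6] -/
theorem existsUnique_mem_dlogSolutions_holds : existsUnique_mem_dlogSolutions := by
  intro p g y h
  classical
  obtain ⟨hp, hg0, hgp, hord, hy0, hyp⟩ := h
  haveI : Fact p.Prime := ⟨hp⟩
  have hgz : (g : ZMod p) ≠ 0 := by
    rw [Ne, ZMod.natCast_eq_zero_iff]
    exact fun hd => absurd (Nat.le_of_dvd hg0 hd) (not_le.2 hgp)
  have hyz : (y : ZMod p) ≠ 0 := by
    rw [Ne, ZMod.natCast_eq_zero_iff]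
    exact fun hd => absurd (Nat.le_of_dvd hy0 hd) (not_le.2 hyp)
  set u : (ZMod p)ˣ := Units.mk0 _ hgz with hu
  set v : (ZMod p)ˣ := Units.mk0 _ hyz with hv
  have hordu : orderOf u = p - 1 := by rw [← orderOf_units]; simpa [u] using hord
  -- `u` generates the unit group: its cyclic subgroup has full cardinality
  have htop : Subgroup.zpowers u = ⊤ :=
    Subgroup.eq_top_of_card_eq _
      (by rw [Nat.card_zpowers, hordu, Nat.card_eq_fintype_card, ZMod.card_units])
  have hvmem : v ∈ Subgroup.zpowers u := by rw [htop]; exact Subgroup.mem_top _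
  rw [(isOfFinOrder_of_finite u).mem_zpowers_iff_mem_range_orderOf, Finset.mem_image] at hvmem
  obtain ⟨a, ha, hav⟩ := hvmem
  rw [Finset.mem_range, hordu] at ha
  -- translate `g ^ b ≡ y [MOD p]` into the unit group
  have hpow : ∀ b, g ^ b ≡ y [MOD p] ↔ u ^ b = v := fun b => by
    rw [← ZMod.natCast_eq_natCast_iff, Units.ext_iff]
    push_cast
    simp [u, v]
  refine ⟨a, (mem_dlogSolutions p g y a).2 ⟨ha, (hpow a).2 hav⟩, fun b hb => ?_⟩
  obtain ⟨hb, hbmod⟩ := (mem_dlogSolutions p g y b).1 hb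
  have := (hpow b).1 hbmod
  rw [← hav, pow_eq_pow_iff_modEq, hordu, Nat.ModEq, Nat.mod_eq_of_lt hb,
    Nat.mod_eq_of_lt ha] at this
  exact this

end DLog

end Literature.Computability.Cryptography
end
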